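import Literature.NumberTheory.ComplexMultiplication.CMAlgebraTorusCommutantCriterion
import Literature.NumberTheory.ComplexMultiplication.CMAlgebraTorusMumfordTateTorus
import Literature.RingTheory.CentralSimple.ReducedDegreeFaithfulEquality
import HarnessLib

/-!
# `[End_ℚ(X) : ℚ]_red ≤ 2 dim X` for a complex torus, with equality iff `X` has multiplication by a CM-algebra of full
# degree (Milne, *Complex Multiplication*, Ch. I Prop. 3.1, Def. 3.2, Prop. 3.3 — torus level)

Family `hodge`, lane `lit-hodgefound` (Track 2 foundations library; skeleton seat `lit-hodgefound-skel-3`, generation 57,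
row **A3-G141** «the reduced degree»), layer `Literature/NumberTheory/ComplexMultiplication`, namespace
`Literature.NumberTheory.ComplexMultiplication`.  FILE 4 of the row: Milne's (a) — `2 dim A = [End⁰(A):ℚ]_red`, FILE 1's
`reducedDegree` — on the TORUS-LEVEL carrier of the tree's Layer A3 (`X = E/P(ℤ^ι)`, `End_ℚ(X) = endAlgRat P ⊆ M_ι(ℚ)`,
`H₁(X, ℚ) = ℚ^ι`, `2 dim X = #ι`), joined BY NAME to the three torus-level forms of «CM» already in the tree: Lange's
(ii) / Milne's (b) (a commutative semisimple `T ⊆ End_ℚ(X)` of dimension `2g`), Milne 2005 Def. 14.9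
(`IsCMAlgTorusRat P ρ`: a ring-injection of a product of number fields of degree `2g`), Deligne's (a) («`MT(X)` is a
torus» / «`Hg(X)` is commutative») and Milne's (c) (A3-G140 FILE 2: the commutant of `End_ℚ(X)` in `M_{2g}(ℚ)` is
commutative).  THEOREMS ONLY (no definition, no instance, no named fact; D-0026 net debt `0`).

## The print

J. S. Milne, *Complex Multiplication* (course notes v0.10, 2020) [MilneCM2006], Ch. I §3 pp. 27–28 (open text
`paper:url-8ccc30e4daab`, p0027 L29 – p0028 L7), VERBATIM: «PROPOSITION 3.1 For any abelian variety `A`,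
`2 dim A ≥ [End⁰(A) : ℚ]_red`. When equality holds, `End⁰(A)` is a product of matrix algebras over fields. …
DEFINITION 3.2 A complex abelian variety `A` is said to have complex multiplication … if `2 dim A = [End⁰(A) : ℚ]_red`.
PROPOSITION 3.3 The following conditions on an abelian variety `A` are equivalent: (a) `A` has complex multiplication;
(b) `End⁰(A)` contains an étale subalgebra of degree `2 dim A` over `ℚ`; (c) … the centralizer of `End⁰(A)` in
`End_Ω(H¹(A))` is commutative …»  Milne states 3.1–3.3 for abelian varieties; the inequality, (a) ⟺ (b) and (b) ⟹ (c)
hold verbatim for every complex torus (only (c) ⟹ (b) and the «product of matrix algebras» clause use the semisimplicity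
of `End⁰`, i.e. a polarisation), and are stated in that generality below.

## What is formalised (`P : (ι → ℝ) ≃L[ℝ] E` the period isomorphism of `X = E/P(ℤ^ι)`, `#ι = 2 dim_ℂ X`)

* §1 **PROP. 3.1 at torus level** `reducedDegree_endAlgRat_le_card`: `[End_ℚ(X) : ℚ]_red ≤ #ι = 2 dim X`
  (`End_ℚ(X) ⊆ M_ι(ℚ)` and `[M_ι(ℚ):ℚ]_red = #ι`, FILE 1).
* §2 **DEF. 3.2 ⟺ (b) ⟺ Def. 14.9 at torus level**: `reducedDegree_endAlgRat_eq_card_iff_exists_comm_isReduced`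
  (`[End_ℚ(X):ℚ]_red = 2 dim X` iff `End_ℚ(X) ⊇ T` commutative reduced of dimension `2 dim X` — Lange (ii)),
  `reducedDegree_endAlgRat_eq_card_iff_exists_isCMAlgTorusRat` (iff `X` has multiplication by a product of number fields
  of degree `2 dim X`, the tree's `IsCMAlgTorusRat`), `IsCMAlgTorusRat.reducedDegree_endAlgRat_eq`; every CM torus
  `ℂ^Φ/u(𝔪)` of the tree therefore has `[End_ℚ : ℚ]_red = 2g`.
* §3 **(a) ⟺ (c) and Deligne's (a)**: for `End_ℚ(X)` semisimple, `[End_ℚ(X):ℚ]_red = 2 dim X` iff the commutant of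
  `End_ℚ(X)` in `M_{2g}(ℚ)` is commutative (`reducedDegree_endAlgRat_eq_card_iff_centralizer_comm`, A3-G140 FILE 2) iff
  `MT(X)(ℂ)` is a torus (`reducedDegree_endAlgRat_eq_card_iff_isTorusSubgroup_mumfordTateGroupC`); for an ABELIAN VARIETY
  `X` (a Riemann form exists): iff `Hg(X)(ℂ)` is commutative (`IsAbelianVariety.reducedDegree_endAlgRat_eq_card_iff_hodgeGroupC_comm`),
  iff the commutant is commutative (`IsAbelianVariety.reducedDegree_endAlgRat_eq_card_iff_centralizer_comm`).
* §4 **PROP. 3.1, second sentence, at torus level** `exists_algEquiv_endAlgRat_pi_matrix_field_of_reducedDegree_eq`: for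
  `End_ℚ(X)` semisimple with `[End_ℚ(X):ℚ]_red = 2 dim X`, `End_ℚ(X) ≃ₐ[ℚ] ∏ᵢ M_{dᵢ}(Kᵢ)` over number fields (FILE 3's
  Prop. 1.2 equality clause for the faithful module `H₁(X, ℚ) = ℚ^ι`); `IsAbelianVariety.…` form.

## References

* [MilneCM2006] J. S. Milne, *Complex Multiplication* (2006/2020), Ch. I §3 Prop. 3.1, Def. 3.2, Prop. 3.3 (pp. 27–28).
* [Milne2005ShimuraVarieties] J. S. Milne, *Introduction to Shimura varieties* (2005), §14 Def. 14.9, Prop. 14.10.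
* [Lange2023AbelianVarietiesComplex] H. Lange, *Abelian Varieties over the Complex Numbers* (2023), §7.2.3 Prop. 7.2.6.
* [Deligne1982HodgeCycles] P. Deligne, *Hodge cycles on abelian varieties*, LNM 900 (1982), I §5 p. 53, Prop. 5.1.
-/

noncomputable section

open Module Matrix

namespace Literature.NumberTheory.ComplexMultiplication

open Literature.RingTheory.CentralSimple
open Literature.Geometry.Kaehler
open Literature.Geometry.Kaehler.ComplexTorus
open Literature.NumberTheory.Automorphic (IsTorusSubgroup)

/-! ## §0 Transport of commutative reduced subalgebras along the inclusion `End_ℚ(X) ⊆ M_ι(ℚ)` -/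

section Transport

variable {F : Type*} [Field F] {C B : Type*} [Ring C] [Ring B] [Algebra F C] [Algebra F B]

/-- Along an injective algebra map `f : C → B`, commutative reduced subalgebras of `C` of dimension `n` correspond to
those of `B` of dimension `n` inside `f(C)`. [folklore] -/
private theorem exists_comm_isReduced_iff_of_injective' (f : C →ₐ[F] B) (hf : Function.Injective f) (n : ℕ) :
    (∃ S : Subalgebra F C, (∀ x ∈ S, ∀ y ∈ S, x * y = y * x) ∧ IsReduced S ∧ finrank F S = n) ↔
      ∃ L : Subalgebra F B, L ≤ f.range ∧ IsReduced L ∧ (∀ x ∈ L, ∀ y ∈ L, x * y = y * x) ∧ finrank F L = n := by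
  constructor
  · rintro ⟨S, hcomm, hred, hdim⟩
    let ψ := Subalgebra.equivMapOfInjective S f hf
    refine ⟨S.map f, ?_, ?_, ?_, ?_⟩
    · rintro _ ⟨x, -, rfl⟩
      exact ⟨x, rfl⟩
    · exact isReduced_of_injective ψ.symm ψ.symm.injective
    · rintro _ ⟨a, ha, rfl⟩ _ ⟨b, hb, rfl⟩
      rw [← map_mul, ← map_mul, hcomm a ha b hb]
    · rw [← hdim]
      exact ψ.symm.toLinearEquiv.finrank_eq
  · rintro ⟨L, hLR, hred, hcomm, hdim⟩
    let S : Subalgebra F C := L.comap f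
    have hSL : S.map f = L := by
      ext y
      constructor
      · rintro ⟨x, hx, rfl⟩
        exact (Subalgebra.mem_comap _ _ _).1 hx
      · intro hy
        obtain ⟨x, rfl⟩ := (AlgHom.mem_range _).1 (hLR hy)
        exact ⟨x, (Subalgebra.mem_comap _ _ _).2 hy, rfl⟩
    let ψ : S ≃ₐ[F] L := (Subalgebra.equivMapOfInjective S f hf).trans (Subalgebra.equivOfEq _ _ hSL)
    refine ⟨S, ?_, isReduced_of_injective ψ ψ.injective, ?_⟩
    · intro a ha b hb
      apply hf
      rw [map_mul, map_mul]
      exact hcomm _ ((Subalgebra.mem_comap _ _ _).1 ha) _ ((Subalgebra.mem_comap _ _ _).1 hb)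
    · rw [← hdim]
      exact ψ.toLinearEquiv.finrank_eq

end Transport

section Torus

variable {ι : Type} [Fintype ι] [DecidableEq ι] {E : Type} [NormedAddCommGroup E] [NormedSpace ℂ E]
  (P : (ι → ℝ) ≃L[ℝ] E)

/-! ## §1 Prop. 3.1 at torus level: `[End_ℚ(X) : ℚ]_red ≤ 2 dim X` -/

/-- **MILNE CM PROP. 3.1 for a complex torus `X = E/P(ℤ^ι)`: `[End_ℚ(X) : ℚ]_red ≤ #ι = 2 dim X`** — `End_ℚ(X)` is a
subalgebra of `End(H₁(X, ℚ)) = M_ι(ℚ)` and `[M_ι(ℚ) : ℚ]_red = #ι` (FILE 1: `reducedDegree_subalgebra_le`,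
`reducedDegree_matrix`; no polarisation needed). [cite: MilneCM2006, Ch. I §3 Prop. 3.1 (p. 27)] -/
theorem reducedDegree_endAlgRat_le_card : reducedDegree ℚ ↥(endAlgRat P) ≤ Fintype.card ι := by
  rcases isEmpty_or_nonempty ι with hι | hι
  · haveI : Subsingleton (Matrix ι ι ℚ) := ⟨fun a b => Matrix.ext fun i _ => (IsEmpty.false i).elim⟩
    haveI : Subsingleton ↥(endAlgRat P) := ⟨fun a b => Subtype.ext (Subsingleton.elim _ _)⟩
    rw [reducedDegree_eq_zero_of_subsingleton]
    exact Nat.zero_le _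
  · calc reducedDegree ℚ ↥(endAlgRat P) ≤ reducedDegree ℚ (Matrix ι ι ℚ) := reducedDegree_subalgebra_le _
      _ = Fintype.card ι := reducedDegree_matrix ι

/-- The same against the complex dimension: `[End_ℚ(X) : ℚ]_red ≤ 2 dim_ℂ E`. [cite: MilneCM2006, Ch. I §3 Prop. 3.1 (p. 27)] -/
theorem reducedDegree_endAlgRat_le_two_mul_finrank [FiniteDimensional ℂ E] :
    reducedDegree ℚ ↥(endAlgRat P) ≤ 2 * finrank ℂ E := by
  have h1 : finrank ℝ (ι → ℝ) = finrank ℝ E := P.toLinearEquiv.finrank_eq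
  rw [finrank_fintype_fun_eq_card, finrank_real_of_complex] at h1
  rw [← h1]
  exact reducedDegree_endAlgRat_le_card P

/-! ## §2 Def. 3.2 ⟺ (b) ⟺ Milne 2005 Def. 14.9, at torus level -/

/-- **MILNE CM DEF. 3.2 ⟺ PROP. 3.3 (b) for a complex torus: `[End_ℚ(X) : ℚ]_red = 2 dim X` iff `End_ℚ(X)` contains a
commutative reduced (semisimple) `ℚ`-subalgebra of dimension `2 dim X`** (Lange's Prop. 7.2.6 (ii)).
[cite: MilneCM2006, Ch. I §3 Def. 3.2 and Prop. 3.3 (a) ⟺ (b) (pp. 27–28)] [cite: Lange2023AbelianVarietiesComplex, §7.2.3 Prop. 7.2.6 (ii), p. 332] -/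
theorem reducedDegree_endAlgRat_eq_card_iff_exists_comm_isReduced :
    reducedDegree ℚ ↥(endAlgRat P) = Fintype.card ι ↔
      ∃ T : Subalgebra ℚ (Matrix ι ι ℚ), T ≤ endAlgRat P ∧ IsReduced T ∧ (∀ a ∈ T, ∀ b ∈ T, a * b = b * a) ∧
        finrank ℚ T = Fintype.card ι := by
  rw [reducedDegree_eq_iff_exists_of_le (reducedDegree_endAlgRat_le_card P),
    exists_comm_isReduced_iff_of_injective' (endAlgRat P).val Subtype.val_injective]
  simp only [Subalgebra.range_val]

/-- **MILNE CM DEF. 3.2 ⟺ MILNE 2005 DEF. 14.9 for a complex torus: `[End_ℚ(X) : ℚ]_red = 2 dim X` iff `X` has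
multiplication by a product of number fields `Y = ∏ᵢ Lᵢ` of degree `2 dim X`** (a ring-injection `ρ : Y → End_ℚ(X)`,
the tree's `IsCMAlgTorusRat P ρ`). [cite: MilneCM2006, Ch. I §3 Def. 3.2 and Prop. 3.3 (pp. 27–28)] [cite: Milne2005ShimuraVarieties, §14 Def. 14.9] -/
theorem reducedDegree_endAlgRat_eq_card_iff_exists_isCMAlgTorusRat :
    reducedDegree ℚ ↥(endAlgRat P) = Fintype.card ι ↔
      ∃ (t : Type) (_ : Fintype t) (L : t → Type) (_ : ∀ i, Field (L i)) (_ : ∀ i, NumberField (L i))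
        (ρ : (Π i, L i) →ₐ[ℚ] Matrix ι ι ℚ), IsCMAlgTorusRat P ρ := by
  rw [reducedDegree_endAlgRat_eq_card_iff_exists_comm_isReduced, exists_isCMAlgTorusRat_iff_exists_comm_isReduced]

variable {P} in
/-- **A complex torus with multiplication by a CM-algebra (product of number fields) of full degree has
`[End_ℚ(X) : ℚ]_red = 2 dim X`** — Milne's (b) ⟹ (a); in particular every CM torus `ℂ^Φ/u(𝔪)` of the tree.
[cite: MilneCM2006, Ch. I §3 Prop. 3.3 ((b) ⟹ (a)) and Example 3.4 (p. 28)] -/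
theorem IsCMAlgTorusRat.reducedDegree_endAlgRat_eq {t : Type} [Fintype t] {L : t → Type} [∀ i, Field (L i)]
    [∀ i, NumberField (L i)] {ρ : (Π i, L i) →ₐ[ℚ] Matrix ι ι ℚ} (h : IsCMAlgTorusRat P ρ) :
    reducedDegree ℚ ↥(endAlgRat P) = Fintype.card ι :=
  (reducedDegree_endAlgRat_eq_card_iff_exists_isCMAlgTorusRat P).2 ⟨t, inferInstance, L, inferInstance, inferInstance, ρ, h⟩

/-- The strict inequality characterises the tori WITHOUT complex multiplication.
[cite: MilneCM2006, Ch. I §3 Prop. 3.1 and Def. 3.2 (p. 27)] -/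
theorem reducedDegree_endAlgRat_lt_card_iff :
    reducedDegree ℚ ↥(endAlgRat P) < Fintype.card ι ↔
      ¬ ∃ (t : Type) (_ : Fintype t) (L : t → Type) (_ : ∀ i, Field (L i)) (_ : ∀ i, NumberField (L i))
        (ρ : (Π i, L i) →ₐ[ℚ] Matrix ι ι ℚ), IsCMAlgTorusRat P ρ := by
  rw [← reducedDegree_endAlgRat_eq_card_iff_exists_isCMAlgTorusRat, Nat.lt_iff_le_and_ne]
  exact ⟨fun h => h.2, fun h => ⟨reducedDegree_endAlgRat_le_card P, h⟩⟩

/-! ## §3 (a) ⟺ (c), and Deligne's (a): `MT(X)` a torus / `Hg(X)` commutative -/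

/-- **MILNE CM PROP. 3.3 (a) ⟺ (c) at torus level**: for a complex torus with `End_ℚ(X)` semisimple,
`[End_ℚ(X) : ℚ]_red = 2 dim X` iff the commutant of `End_ℚ(X)` in `End(H₁(X, ℚ)) = M_{2g}(ℚ)` is commutative
(A3-G140 FILE 2). [cite: MilneCM2006, Ch. I §3 Prop. 3.3 ((a) ⟺ (c), pp. 27–28)] -/
theorem reducedDegree_endAlgRat_eq_card_iff_centralizer_comm [IsSemisimpleRing ↥(endAlgRat P)] :
    reducedDegree ℚ ↥(endAlgRat P) = Fintype.card ι ↔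
      ∀ x ∈ Subalgebra.centralizer ℚ (endAlgRat P : Set (Matrix ι ι ℚ)),
        ∀ y ∈ Subalgebra.centralizer ℚ (endAlgRat P : Set (Matrix ι ι ℚ)), x * y = y * x := by
  rw [reducedDegree_endAlgRat_eq_card_iff_exists_comm_isReduced,
    exists_comm_isReduced_le_endAlgRat_iff_centralizer_comm]

/-- **MILNE'S (a) ⟺ DELIGNE'S (a) at torus level**: for `End_ℚ(X)` semisimple, `[End_ℚ(X) : ℚ]_red = 2 dim X` iff the
Mumford–Tate group `MT(X)(ℂ)` is a torus (the tree's `isTorusSubgroup_mumfordTateGroupC_iff`).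
[cite: MilneCM2006, Ch. I §3 Def. 3.2 (p. 27)] [cite: Deligne1982HodgeCycles, I §5 p. 53 («of CM-type if its Mumford–Tate group is commutative»)] -/
theorem reducedDegree_endAlgRat_eq_card_iff_isTorusSubgroup_mumfordTateGroupC [IsSemisimpleRing ↥(endAlgRat P)] :
    reducedDegree ℚ ↥(endAlgRat P) = Fintype.card ι ↔ IsTorusSubgroup (mumfordTateGroupC P) := by
  rw [reducedDegree_endAlgRat_eq_card_iff_exists_isCMAlgTorusRat,
    exists_isCMAlgTorusRat_iff_isTorusSubgroup_mumfordTateGroupC]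

variable {P}

/-- **For an ABELIAN VARIETY `X = E/P(ℤ^ι)`: `[End_ℚ(X) : ℚ]_red = 2 dim X` iff the Hodge group `Hg(X)(ℂ)` is
commutative** (Deligne I §5: «of CM-type if its Mumford–Tate group is commutative»; Lange Prop. 7.2.6 (i) ⟺ (ii)).
[cite: MilneCM2006, Ch. I §3 Def. 3.2 and Prop. 3.3 (pp. 27–28)] [cite: Deligne1982HodgeCycles, I §5 p. 53 and Prop. 5.1]
[cite: Lange2023AbelianVarietiesComplex, §7.2.3 Prop. 7.2.6] -/
theorem _root_.Literature.Geometry.Kaehler.ComplexTorus.IsAbelianVariety.reducedDegree_endAlgRat_eq_card_iff_hodgeGroupC_comm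
    (hX : IsAbelianVariety P) :
    reducedDegree ℚ ↥(endAlgRat P) = Fintype.card ι ↔ ∀ M ∈ hodgeGroupC P, ∀ N ∈ hodgeGroupC P, M * N = N * M := by
  rw [reducedDegree_endAlgRat_eq_card_iff_exists_comm_isReduced,
    hX.hodgeGroupC_comm_iff_exists_comm_isReduced_le_endAlgRat]

/-- For an abelian variety: `[End_ℚ(X) : ℚ]_red = 2 dim X` iff the commutant of `End_ℚ(X)` in `M_{2g}(ℚ)` is commutative
(no semisimplicity hypothesis to supply: Poincaré). [cite: MilneCM2006, Ch. I §3 Prop. 3.3 ((a) ⟺ (c), pp. 27–28)] -/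
theorem _root_.Literature.Geometry.Kaehler.ComplexTorus.IsAbelianVariety.reducedDegree_endAlgRat_eq_card_iff_centralizer_comm
    (hX : IsAbelianVariety P) :
    reducedDegree ℚ ↥(endAlgRat P) = Fintype.card ι ↔
      ∀ x ∈ Subalgebra.centralizer ℚ (endAlgRat P : Set (Matrix ι ι ℚ)),
        ∀ y ∈ Subalgebra.centralizer ℚ (endAlgRat P : Set (Matrix ι ι ℚ)), x * y = y * x := by
  haveI := hX.isSemisimpleRing_endAlgRat
  exact Literature.NumberTheory.ComplexMultiplication.reducedDegree_endAlgRat_eq_card_iff_centralizer_comm P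

/-- For an abelian variety: `[End_ℚ(X) : ℚ]_red = 2 dim X` iff `MT(X)(ℂ)` is a torus.
[cite: MilneCM2006, Ch. I §3 Def. 3.2 (p. 27)] [cite: Deligne1982HodgeCycles, I §5 p. 53] -/
theorem _root_.Literature.Geometry.Kaehler.ComplexTorus.IsAbelianVariety.reducedDegree_endAlgRat_eq_card_iff_isTorusSubgroup_mumfordTateGroupC
    (hX : IsAbelianVariety P) :
    reducedDegree ℚ ↥(endAlgRat P) = Fintype.card ι ↔ IsTorusSubgroup (mumfordTateGroupC P) := by
  haveI := hX.isSemisimpleRing_endAlgRat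
  exact Literature.NumberTheory.ComplexMultiplication.reducedDegree_endAlgRat_eq_card_iff_isTorusSubgroup_mumfordTateGroupC P

/-! ## §4 Prop. 3.1, second sentence, at torus level -/

variable (P) in
/-- **MILNE CM PROP. 3.1, second sentence, at torus level: for `End_ℚ(X)` semisimple with `[End_ℚ(X) : ℚ]_red = 2 dim X`,
`End_ℚ(X) ≃ₐ[ℚ] ∏ᵢ M_{dᵢ}(Kᵢ)` over number fields `Kᵢ`** — FILE 3's Prop. 1.2 equality clause for the faithful module
`H₁(X, ℚ) = ℚ^ι` (matrices acting on column vectors), of dimension `#ι = [End_ℚ(X):ℚ]_red`.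
[cite: MilneCM2006, Ch. I §3 Prop. 3.1 (p. 27) and §1 Prop. 1.2 (p. 9)] -/
theorem exists_algEquiv_endAlgRat_pi_matrix_field_of_reducedDegree_eq [IsSemisimpleRing ↥(endAlgRat P)]
    (h : reducedDegree ℚ ↥(endAlgRat P) = Fintype.card ι) :
    ∃ (n : ℕ) (K : Fin n → Type) (_ : ∀ i, Field (K i)) (_ : ∀ i, Algebra ℚ (K i)) (d : Fin n → ℕ),
      (∀ i, NeZero (d i)) ∧ (∀ i, FiniteDimensional ℚ (K i)) ∧
        Nonempty (↥(endAlgRat P) ≃ₐ[ℚ] Π i, Matrix (Fin (d i)) (Fin (d i)) (K i)) := by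
  -- `ℚ^ι` as a faithful `End_ℚ(X)`-module: `A • v = A *ᵥ v`
  let act : ↥(endAlgRat P) →+* Module.End ℚ (ι → ℚ) :=
    ((Matrix.toLinAlgEquiv' : Matrix ι ι ℚ ≃ₐ[ℚ] Module.End ℚ (ι → ℚ)).toAlgHom.comp (endAlgRat P).val).toRingHom
  have hact : ∀ (A : ↥(endAlgRat P)) (v : ι → ℚ), act A v = (A : Matrix ι ι ℚ).mulVec v := fun A v =>
    Matrix.toLinAlgEquiv'_apply _ _
  letI : Module ↥(endAlgRat P) (ι → ℚ) := Module.compHom _ act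
  haveI : IsScalarTower ℚ ↥(endAlgRat P) (ι → ℚ) := ⟨fun c A v => by
    change act (c • A) v = c • act A v
    rw [hact, hact, Subalgebra.coe_smul, Matrix.smul_mulVec]⟩
  have hfaith : ∀ A : ↥(endAlgRat P), (∀ v : ι → ℚ, A • v = 0) → A = 0 := by
    intro A hA
    have h0 : act A = 0 := LinearMap.ext fun v => hA v
    have h1 : (A : Matrix ι ι ℚ) = 0 := by
      have h2 : Matrix.toLinAlgEquiv' (A : Matrix ι ι ℚ) = Matrix.toLinAlgEquiv' (0 : Matrix ι ι ℚ) := by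
        rw [map_zero]
        exact h0
      exact Matrix.toLinAlgEquiv'.injective h2
    exact Subtype.ext h1
  have hdim : finrank ℚ (ι → ℚ) = reducedDegree ℚ ↥(endAlgRat P) := by
    rw [finrank_fintype_fun_eq_card, h]
  exact exists_algEquiv_pi_matrix_field_of_faithful_finrank_eq hfaith hdim

/-- **For an ABELIAN VARIETY `X` with `[End_ℚ(X) : ℚ]_red = 2 dim X`: `End_ℚ(X) ≃ₐ[ℚ] ∏ᵢ M_{dᵢ}(Kᵢ)` over number
fields** (Poincaré supplies the semisimplicity). [cite: MilneCM2006, Ch. I §3 Prop. 3.1 (p. 27)] -/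
theorem _root_.Literature.Geometry.Kaehler.ComplexTorus.IsAbelianVariety.exists_algEquiv_endAlgRat_pi_matrix_field
    (hX : IsAbelianVariety P) (h : reducedDegree ℚ ↥(endAlgRat P) = Fintype.card ι) :
    ∃ (n : ℕ) (K : Fin n → Type) (_ : ∀ i, Field (K i)) (_ : ∀ i, Algebra ℚ (K i)) (d : Fin n → ℕ),
      (∀ i, NeZero (d i)) ∧ (∀ i, FiniteDimensional ℚ (K i)) ∧
        Nonempty (↥(endAlgRat P) ≃ₐ[ℚ] Π i, Matrix (Fin (d i)) (Fin (d i)) (K i)) := by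
  haveI := hX.isSemisimpleRing_endAlgRat
  exact Literature.NumberTheory.ComplexMultiplication.exists_algEquiv_endAlgRat_pi_matrix_field_of_reducedDegree_eq P h

/-- In particular **every polarised torus with multiplication by a CM-algebra of full degree has
`End_ℚ(X) ≃ ∏ᵢ M_{dᵢ}(Kᵢ)` over number fields** (`IsCMAlgTorusRat` ⟹ `[End_ℚ:ℚ]_red = 2g`, §2).
[cite: MilneCM2006, Ch. I §3 Prop. 3.1 and Remark 3.5 (pp. 27–28)] -/
theorem IsCMAlgTorusRat.exists_algEquiv_endAlgRat_pi_matrix_field {t : Type} [Fintype t] {L : t → Type}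
    [∀ i, Field (L i)] [∀ i, NumberField (L i)] {ρ : (Π i, L i) →ₐ[ℚ] Matrix ι ι ℚ} (h : IsCMAlgTorusRat P ρ)
    (hX : IsAbelianVariety P) :
    ∃ (n : ℕ) (K : Fin n → Type) (_ : ∀ i, Field (K i)) (_ : ∀ i, Algebra ℚ (K i)) (d : Fin n → ℕ),
      (∀ i, NeZero (d i)) ∧ (∀ i, FiniteDimensional ℚ (K i)) ∧
        Nonempty (↥(endAlgRat P) ≃ₐ[ℚ] Π i, Matrix (Fin (d i)) (Fin (d i)) (K i)) :=
  hX.exists_algEquiv_endAlgRat_pi_matrix_field h.reducedDegree_endAlgRat_eq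

end Torus

end Literature.NumberTheory.ComplexMultiplication
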